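import Literature.Computability.AlgebraicComplexity.BLMW11FormulasWeaklySkew
import Literature.Computability.AlgebraicComplexity.ValiantCompleteness
import Mathlib.Algebra.MvPolynomial.PDeriv
import HarnessLib

/-!
# The permanent is a coefficient of a formula-size-`O(n²)` family: `VF`, `VBP`, `VP` are not
# closed under taking coefficients unless they contain `VNP` (Bürgisser 2024 survey, §3.1) — PROVED

Topic `Computability/AlgebraicComplexity`. Cell `val-lit`, row Bur2024-A (P. Bürgisser,
*Completeness classes in algebraic complexity theory*, arXiv:2406.06217, 2024), §3.1 "Robustness",
companion of `VNPClosedUnderCoefficients.lean` (Prop. 3.1: `VNP` IS closed under taking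
coefficients). The survey continues (held text `paper:arxiv-2406.06217`, p0013 L28–L37):

> However, none of the classes `VF`, `VBP` and `VP` shares this property, if `VP ≠ VNP`. This can
> be seen from the following example. Consider `f_n := ∏_{i=1}^n ( Σ_{j=1}^n x_{ij} y_j )`. The
> family `(f_n)` lies in `VF` since `E(f_n) = O(n²)`. On the other hand, the coefficient of the
> product `Y_1 ⋯ Y_n` in `f_n` equals the permanent `PER_n`.

(The same device, with one variable `Y` and the exponents `2^{j-1}`, is Bürgisser 2004, Prop. 5.3.)
This file proves these statements in the tree's vocabulary. Coefficient sequences are taken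
exactly as in `IsVNPFamily.coeff` (`VNPClosedUnderCoefficients.lean`): for
`f ∈ R[Fin a ⊔ τ] ≃ R[τ][Fin a]` (Mathlib's `sumAlgEquiv`) and a monomial `m` in the first block of
variables, the coefficient is `coeff m (sumAlgEquiv R _ _ f) ∈ R[τ]`. The survey's classes are the
tree's: `VP` = `IsVPFamily`; `VBP` = the weakly-skew class `IsVPwsFamily` and `VF` = p-bounded
expression size `formulaComplexity` (the survey DEFINES `VBP` by weakly-skew circuits and `VF` by
formulas, Def. 2.9, and notes "`VBP` is sometimes denoted `VP_ws` … while `VF` is denoted `VP_e`",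
Rem. 2.10(3), p0006 L57–L92); `PER_n` = `perPoly (Fin n)`.

* `coeff_prod_linearForm_eq_permanent` — over any commutative semiring, the coefficient of
  `y₁ ⋯ yₙ` in `∏_i (Σ_j M_{ij} y_j)` is `per M` (the algebraic identity behind the example);
* `coeff_prod_sum_X_mul_X_eq_perPoly` — **"the coefficient of `Y_1 ⋯ Y_n` in `f_n` equals
  `PER_n`"** for `f = ∏_i Σ_j x_{ij} y_j ∈ R[y ⊔ x]`;
* `formulaComplexity_prod_sum_X_mul_X_le` — **`E(f_n) ≤ 2n² + n`** ("`E(f_n) = O(n²)`"), whence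
  `isPBounded_formulaComplexity_prod_sum_X_mul_X` (`(f_n) ∈ VF`), `isVPwsFamily_prod_sum_X_mul_X`
  (`∈ VBP`), `isVPFamily_prod_sum_X_mul_X` (`∈ VP`);
* the closure failures, as implications with the closure property as hypothesis (over a field of
  characteristic `≠ 2`, where the permanent is `VNP`-complete — the tree's theorem
  `isVNPComplete_perPoly_holds`): if `VP` (resp. `VBP`, `VF`) is closed under taking coefficients
  then `(PER_n) ∈ VP` (resp. `VBP`, `VF`) — `isVPFamily_perPoly_of_coeff_closed`,
  `isVPwsFamily_perPoly_of_coeff_closed`, `isPBounded_formulaComplexity_perPoly_of_coeff_closed` —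
  and hence every `VNP` family lies in `VP` (resp. `VBP`, `VF`):
  `IsVNPFamily.isVPFamily_of_coeff_closed`, `IsVNPFamily.isVPwsFamily_of_coeff_closed`,
  `IsVNPFamily.isPBounded_formulaComplexity_of_coeff_closed`;
* `foldr_pderiv_prod_sum_X_mul_X_eq_perPoly` (and the `Fin n` form
  `foldr_pderiv_finRange_prod_sum_X_mul_X_eq_perPoly`) — the survey's displayed formula
  **`∂/∂y₁ ⋯ ∂/∂yₙ f_n = PER_n`** (p0013 L39–L47: "Valiant also proved in [Valiant 1982] that
  `VNP` is closed under `p`-bounded applications of differentiation and integration. Again, the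
  classes `VF`, `VBP`, and `VP` fail to be closed under these operations, as the following formula
  shows"), with Mathlib's `pderiv`; the integral expression of the same display is not rendered;
  whence, exactly as for coefficients, `isVPFamily_perPoly_of_pderiv_closed`,
  `isVPwsFamily_perPoly_of_pderiv_closed`, `isPBounded_formulaComplexity_perPoly_of_pderiv_closed`
  and `IsVNPFamily.isVPFamily_of_pderiv_closed`, `IsVNPFamily.isVPwsFamily_of_pderiv_closed`,
  `IsVNPFamily.isPBounded_formulaComplexity_of_pderiv_closed` (closure under differentiating once
  in each of a set of distinguished variables already forces `(PER_n)` into the class).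

Theorems only; 0 definitions, 0 named facts. Honest framing: these are the survey's elementary
remarks, proved; the implications have the (believed false) closure properties as HYPOTHESES and
assert nothing about `VP` versus `VNP`; `VP ≠ VNP` is NOT proved.

## References

* [Burgisser2024Completeness] P. Bürgisser, *Completeness classes in algebraic complexity theory*,
  arXiv:2406.06217 (2024), §3.1 (p0013 L28–L37); Def. 2.9, Rem. 2.10(3) (p0006).
* [Burgisser2004Factors] P. Bürgisser, *The complexity of factors of multivariate polynomials*,
  Found. Comput. Math. 4 (2004), Prop. 5.3 (the one-variable variant).
* [Valiant1982] L. G. Valiant, *Reducibility by algebraic projections*, L'Enseignement Math. 28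
  (1982), 253–268 (`VNP` closed under coefficients; the source the survey cites).
* [BurgisserClausenShokrollahi1997] Bürgisser–Clausen–Shokrollahi, *Algebraic Complexity Theory*
  (1997), §21.1, p. 549 (expression size bookkeeping `E(f ± g), E(f g) ≤ E(f) + E(g) + 1`).
-/

noncomputable section

open MvPolynomial

namespace Literature.Computability.AlgebraicComplexity

universe u v

/-! ## The permanent as the coefficient of `y₁ ⋯ yₙ` in a product of linear forms -/

section Permanent

variable {R : Type u} [CommSemiring R] {ι : Type v} [Fintype ι] [DecidableEq ι]

/-- The exponent vector `Σ_i e_{φ(i)}` evaluated at `j` counts the fibre of `φ` over `j`.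
[cite: Burgisser2024Completeness, §3.1 (p0013 L28–L37)] -/
private theorem sum_single_apply (φ : ι → ι) (j : ι) :
    (∑ i, Finsupp.single (φ i) (1 : ℕ)) j = (Finset.univ.filter fun i => φ i = j).card := by
  rw [Finsupp.finsetSum_apply, Finset.card_filter]
  exact Finset.sum_congr rfl fun i _ => Finsupp.single_apply

/-- The exponent vector `(1, …, 1)` of `y₁ ⋯ yₙ` has all entries `1`.
[cite: Burgisser2024Completeness, §3.1 (p0013 L28–L37)] -/
private theorem sum_single_self_apply (j : ι) : (∑ j' : ι, Finsupp.single j' (1 : ℕ)) j = 1 := by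
  rw [Finsupp.finsetSum_apply]
  simp [Finsupp.single_apply]

/-- `Σ_i e_{φ(i)} = (1, …, 1)` iff `φ` is a permutation: the monomial `∏_i y_{φ(i)}` is
`y₁ ⋯ yₙ` exactly when `φ` is bijective. [cite: Burgisser2024Completeness, §3.1 (p0013 L28–L37)] -/
private theorem sum_single_eq_iff_bijective (φ : ι → ι) :
    (∑ i, Finsupp.single (φ i) (1 : ℕ)) = ∑ j, Finsupp.single j 1 ↔ Function.Bijective φ := by
  constructor
  · intro h
    have hcard : ∀ j, (Finset.univ.filter fun i => φ i = j).card = 1 := fun j => by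
      rw [← sum_single_apply, h, sum_single_self_apply]
    refine ⟨fun a b hab => ?_, fun j => ?_⟩
    · obtain ⟨c, hc⟩ := Finset.card_eq_one.mp (hcard (φ b))
      have ha : a ∈ Finset.univ.filter fun i => φ i = φ b :=
        Finset.mem_filter.2 ⟨Finset.mem_univ _, hab⟩
      have hb : b ∈ Finset.univ.filter fun i => φ i = φ b :=
        Finset.mem_filter.2 ⟨Finset.mem_univ _, rfl⟩
      rw [hc, Finset.mem_singleton] at ha hb
      rw [ha, hb]
    · obtain ⟨c, hc⟩ := Finset.card_eq_one.mp (hcard j)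
      have hcj : c ∈ Finset.univ.filter fun i => φ i = j := by
        rw [hc]
        exact Finset.mem_singleton_self c
      exact ⟨c, (Finset.mem_filter.1 hcj).2⟩
  · intro hφ
    exact Equiv.sum_comp (Equiv.ofBijective φ hφ) fun j => Finsupp.single j (1 : ℕ)

/-- The fibres of a permutation are singletons. [cite: Burgisser2024Completeness, §3.1 (p0013 L28–L37)] -/
private theorem card_filter_eq_one_of_bijective {φ : ι → ι} (hφ : Function.Bijective φ) (j : ι) :
    (Finset.univ.filter fun i => φ i = j).card = 1 := by
  rw [← sum_single_apply, (sum_single_eq_iff_bijective φ).2 hφ, sum_single_self_apply]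

/-- A non-bijective self-map of a finite set has an empty fibre.
[cite: Burgisser2024Completeness, §3.1 (p0013 L28–L37)] -/
private theorem exists_card_filter_eq_zero_of_not_bijective {φ : ι → ι}
    (hφ : ¬Function.Bijective φ) : ∃ j, (Finset.univ.filter fun i => φ i = j).card = 0 := by
  have hs : ¬Function.Surjective φ := fun h => hφ (Finite.surjective_iff_bijective.1 h)
  obtain ⟨j, hj⟩ := not_forall.1 hs
  exact ⟨j, Finset.card_eq_zero.2 (Finset.filter_eq_empty_iff.2 fun i _ hi => hj ⟨i, hi⟩)⟩

/-- A sum over all self-maps of a term supported on the bijective ones is a sum over the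
permutations. [cite: Burgisser2024Completeness, §3.1 (p0013 L28–L37)] -/
private theorem sum_ite_bijective_eq_sum_perm {M : Type*} [AddCommMonoid M] (g : (ι → ι) → M) :
    (∑ φ : ι → ι, if Function.Bijective φ then g φ else 0) = ∑ σ : Equiv.Perm ι, g σ := by
  rw [← Finset.sum_filter]
  exact (Finset.sum_bij (fun (σ : Equiv.Perm ι) _ => (σ : ι → ι))
    (fun σ _ => Finset.mem_filter.2 ⟨Finset.mem_univ _, σ.bijective⟩)
    (fun _ _ _ _ h => Equiv.ext fun i => congr_fun h i)
    (fun φ hφ => ⟨Equiv.ofBijective φ (Finset.mem_filter.1 hφ).2, Finset.mem_univ _, rfl⟩)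
    (fun _ _ => rfl)).symm

/-- **The permanent is the coefficient of `y₁ ⋯ yₙ` in `∏_i (Σ_j M_{ij} y_j)`**, for a square
matrix `M` over any commutative semiring: expanding the product gives `Σ_φ (∏_i M_{i φ(i)}) ∏_i
y_{φ(i)}` over all maps `φ`, and `∏_i y_{φ(i)} = y₁ ⋯ yₙ` iff `φ` is a permutation (the survey's
"the coefficient of the product `Y_1 ⋯ Y_n` in `f_n` equals the permanent", with general
coefficients). [cite: Burgisser2024Completeness, §3.1 (p0013 L28–L37)] -/
theorem coeff_prod_linearForm_eq_permanent (M : Matrix ι ι R) :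
    coeff (∑ j, Finsupp.single j 1) (∏ i, ∑ j, C (M i j) * X j : MvPolynomial ι R) =
      M.permanent := by
  have hterm : ∀ φ : ι → ι, (∏ i, C (M i (φ i)) * X (φ i) : MvPolynomial ι R) =
      monomial (∑ i, Finsupp.single (φ i) 1) (∏ i, M i (φ i)) := fun φ => by
    rw [monomial_sum_prod]
    exact Finset.prod_congr rfl fun i _ => C_mul_X_eq_monomial
  have hcoeff : ∀ φ : ι → ι, coeff (∑ j, Finsupp.single j 1)
      (monomial (∑ i, Finsupp.single (φ i) 1) (∏ i, M i (φ i)) : MvPolynomial ι R) =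
        if Function.Bijective φ then ∏ i, M i (φ i) else 0 := fun φ => by
    rw [coeff_monomial]
    by_cases hφ : Function.Bijective φ
    · rw [if_pos ((sum_single_eq_iff_bijective φ).2 hφ), if_pos hφ]
    · rw [if_neg (mt (sum_single_eq_iff_bijective φ).1 hφ), if_neg hφ]
  rw [Fintype.prod_sum, coeff_sum]
  simp_rw [hterm, hcoeff]
  rw [sum_ite_bijective_eq_sum_perm, ← Matrix.permanent_transpose, Matrix.permanent]
  simp only [Matrix.transpose_apply]

end Permanent

/-! ## The survey's family `f_n = ∏_i (Σ_j x_{ij} y_j)` -/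

section Family

variable (R : Type u) [CommSemiring R] (ι : Type v) [Fintype ι]

/-- Under `R[y ⊔ x] ≃ R[x][y]` (`sumAlgEquiv`) the polynomial `f = ∏_i Σ_j x_{ij} y_j` is the
product of the linear forms `Σ_j x_{ij} y_j` in `y` whose coefficient matrix is the generic matrix
`(x_{ij})`. [cite: Burgisser2024Completeness, §3.1 (p0013 L28–L37)] -/
theorem sumAlgEquiv_prod_sum_X_mul_X :
    sumAlgEquiv R ι (ι × ι) (∏ i : ι, ∑ j : ι, X (Sum.inr (i, j)) * X (Sum.inl j)) =
      ∏ i : ι, ∑ j : ι, C (X (i, j)) * X j := by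
  simp only [map_prod, map_sum, map_mul, sumAlgEquiv_X_inr, sumAlgEquiv_X_inl]

/-- **Bürgisser 2024, §3.1: "the coefficient of the product `Y_1 ⋯ Y_n` in
`f_n = ∏_i (Σ_j x_{ij} y_j)` equals the permanent `PER_n`"** — for the tree's generic permanent
`perPoly` and coefficients taken as in `IsVNPFamily.coeff` (the variables `y` form the first
block of `ι ⊕ ι × ι`). [cite: Burgisser2024Completeness, §3.1 (p0013 L28–L37)] [cite: Burgisser2004Factors, Prop. 5.3 (one-variable variant)] -/
theorem coeff_prod_sum_X_mul_X_eq_perPoly [DecidableEq ι] :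
    coeff (∑ j : ι, Finsupp.single j 1)
        (sumAlgEquiv R ι (ι × ι) (∏ i : ι, ∑ j : ι, X (Sum.inr (i, j)) * X (Sum.inl j))) =
      perPoly ι R := by
  rw [sumAlgEquiv_prod_sum_X_mul_X]
  exact coeff_prod_linearForm_eq_permanent (Matrix.mvPolynomialX ι ι R)

/-! ### Expression size `E(f_n) = O(n²)` -/

section FormulaSize

variable {R} {σ : Type v}

/-- `E(1) = 0` (a constant leaf). [cite: BurgisserClausenShokrollahi1997, §21.1 p. 549] -/
private theorem formulaComplexity_one_le : formulaComplexity (1 : MvPolynomial σ R) ≤ 0 :=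
  (exists_wexpr_iff_formulaComplexity_le _ 0).1 ⟨.const 1, by simp, by simp⟩

/-- `E(0) = 0` (a constant leaf). [cite: BurgisserClausenShokrollahi1997, §21.1 p. 549] -/
private theorem formulaComplexity_zero_le : formulaComplexity (0 : MvPolynomial σ R) ≤ 0 :=
  (exists_wexpr_iff_formulaComplexity_le _ 0).1 ⟨.const 0, by simp, by simp⟩

/-- `E(X_a X_b) ≤ 1` (one product gate). [cite: BurgisserClausenShokrollahi1997, §21.1 p. 549] -/
private theorem formulaComplexity_X_mul_X_le (a b : σ) :
    formulaComplexity (X a * X b : MvPolynomial σ R) ≤ 1 :=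
  (exists_wexpr_iff_formulaComplexity_le _ 1).1 ⟨.mul (.var a) (.var b), by simp, by simp⟩

/-- Sums: `E(Σ_{i ∈ s} u_i) ≤ Σ_{i ∈ s} (E(u_i) + 1)`. [cite: BurgisserClausenShokrollahi1997, §21.1 p. 549] -/
private theorem formulaComplexity_sum_le {α : Type*} (s : Finset α) (u : α → MvPolynomial σ R) :
    formulaComplexity (∑ i ∈ s, u i) ≤ ∑ i ∈ s, (formulaComplexity (u i) + 1) := by
  classical
  induction s using Finset.induction_on with
  | empty =>
    rw [Finset.sum_empty, Finset.sum_empty]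
    exact formulaComplexity_zero_le
  | insert a s ha ih =>
    rw [Finset.sum_insert ha, Finset.sum_insert ha]
    exact (formulaComplexity_add_le _ _).trans (by omega)

/-- Products: `E(∏_{i ∈ s} u_i) ≤ Σ_{i ∈ s} (E(u_i) + 1)`. [cite: BurgisserClausenShokrollahi1997, §21.1 p. 549] -/
private theorem formulaComplexity_prod_le {α : Type*} (s : Finset α) (u : α → MvPolynomial σ R) :
    formulaComplexity (∏ i ∈ s, u i) ≤ ∑ i ∈ s, (formulaComplexity (u i) + 1) := by
  classical
  induction s using Finset.induction_on with
  | empty =>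
    rw [Finset.prod_empty, Finset.sum_empty]
    exact formulaComplexity_one_le
  | insert a s ha ih =>
    rw [Finset.prod_insert ha, Finset.sum_insert ha]
    exact (formulaComplexity_mul_le _ _).trans (by omega)

end FormulaSize

/-- **Bürgisser 2024, §3.1: "`E(f_n) = O(n²)`"** — the expression size of
`f = ∏_i (Σ_j x_{ij} y_j)` (`n = #ι`) is at most `2n² + n`: each product `x_{ij} y_j` costs one
gate, each inner sum `n` more, the outer product `n` more.
[cite: Burgisser2024Completeness, §3.1 (p0013 L28–L37)] -/
theorem formulaComplexity_prod_sum_X_mul_X_le :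
    formulaComplexity (∏ i : ι, ∑ j : ι, X (Sum.inr (i, j)) * X (Sum.inl j) :
      MvPolynomial (ι ⊕ ι × ι) R) ≤ 2 * Fintype.card ι * Fintype.card ι + Fintype.card ι := by
  have hlin : ∀ i : ι, formulaComplexity (∑ j : ι, X (Sum.inr (i, j)) * X (Sum.inl j) :
      MvPolynomial (ι ⊕ ι × ι) R) ≤ 2 * Fintype.card ι := fun i => by
    refine (formulaComplexity_sum_le _ _).trans ?_
    calc ∑ j : ι, (formulaComplexity (X (Sum.inr (i, j)) * X (Sum.inl j) :
            MvPolynomial (ι ⊕ ι × ι) R) + 1)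
        ≤ ∑ _j : ι, 2 := Finset.sum_le_sum fun j _ =>
          Nat.add_le_add_right (formulaComplexity_X_mul_X_le (R := R) _ _) 1
      _ = 2 * Fintype.card ι := by
          rw [Finset.sum_const, Finset.card_univ, smul_eq_mul, mul_comm]
  refine (formulaComplexity_prod_le _ _).trans ?_
  calc ∑ i : ι, (formulaComplexity (∑ j : ι, X (Sum.inr (i, j)) * X (Sum.inl j) :
          MvPolynomial (ι ⊕ ι × ι) R) + 1)
      ≤ ∑ _i : ι, (2 * Fintype.card ι + 1) :=
        Finset.sum_le_sum fun i _ => Nat.add_le_add_right (hlin i) 1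
    _ = 2 * Fintype.card ι * Fintype.card ι + Fintype.card ι := by
        rw [Finset.sum_const, Finset.card_univ, smul_eq_mul]
        ring

/-- **`(f_n) ∈ VF`** (Bürgisser 2024, §3.1: "The family `(f_n)` lies in `VF` since
`E(f_n) = O(n²)`"), in the tree's rendering of `VF = VP_e` as p-bounded expression size.
[cite: Burgisser2024Completeness, §3.1 (p0013 L28–L37)] -/
theorem isPBounded_formulaComplexity_prod_sum_X_mul_X :
    IsPBounded fun n => formulaComplexity (∏ i : Fin n, ∑ j : Fin n,
      X (Sum.inr (i, j)) * X (Sum.inl j) : MvPolynomial (Fin n ⊕ Fin n × Fin n) R) := by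
  refine (IsPBounded.iff_exists_le_mul_succ_pow _).2 ⟨3, 2, fun n => ?_⟩
  refine (formulaComplexity_prod_sum_X_mul_X_le R (Fin n)).trans ?_
  rw [Fintype.card_fin]
  nlinarith

/-- **`(f_n) ∈ VBP`** (the survey's `VBP` is the weakly-skew class, Def. 2.9; the tree's
`IsVPwsFamily`), since `VF ⊆ VBP`. [cite: Burgisser2024Completeness, §3.1 (p0013 L28–L37) and Def. 2.9 (p0006)] -/
theorem isVPwsFamily_prod_sum_X_mul_X :
    IsVPwsFamily fun n => (∏ i : Fin n, ∑ j : Fin n,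
      X (Sum.inr (i, j)) * X (Sum.inl j) : MvPolynomial (Fin n ⊕ Fin n × Fin n) R) :=
  IsVPwsFamily.of_isPBounded_formulaComplexity (isPBounded_formulaComplexity_prod_sum_X_mul_X R)

/-- The variable count `n + n²` of `f_n` is p-bounded. [cite: Burgisser2024Completeness, §3.1 (p0013 L28–L37)] -/
private theorem isPBounded_card_vars :
    IsPBounded fun n => Fintype.card (Fin n ⊕ Fin n × Fin n) := by
  refine (IsPBounded.iff_exists_le_mul_succ_pow _).2 ⟨1, 2, fun n => ?_⟩
  simp only [Fintype.card_sum, Fintype.card_prod, Fintype.card_fin]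
  nlinarith

/-- **`(f_n) ∈ VP`**, since `VF ⊆ VP` (`n + n²` variables, p-bounded expression size).
[cite: Burgisser2024Completeness, §3.1 (p0013 L28–L37)] -/
theorem isVPFamily_prod_sum_X_mul_X :
    IsVPFamily fun n => (∏ i : Fin n, ∑ j : Fin n,
      X (Sum.inr (i, j)) * X (Sum.inl j) : MvPolynomial (Fin n ⊕ Fin n × Fin n) R) :=
  isVPFamily_of_isPBounded_formulaComplexity (isPBounded_formulaComplexity_prod_sum_X_mul_X R)
    isPBounded_card_vars

end Family

/-! ## `∂/∂y₁ ⋯ ∂/∂yₙ f_n = PER_n` -/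

section Derivative

variable (R : Type u) [CommSemiring R] {ι : Type v} [Fintype ι] [DecidableEq ι]

variable {R} in
omit [Fintype ι] [DecidableEq ι] in
/-- Iterated partial derivatives form a linear operator. [cite: Burgisser2024Completeness, §3.1 (p0013 L39–L47)] -/
private theorem exists_linearMap_foldr_pderiv {τ : Type*} (v : ι → τ) (l : List ι) :
    ∃ L : MvPolynomial τ R →ₗ[R] MvPolynomial τ R,
      ∀ p, l.foldr (fun j p => pderiv (v j) p) p = L p := by
  induction l with
  | nil => exact ⟨LinearMap.id, fun _ => rfl⟩
  | cons a l ih =>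
    obtain ⟨L, hL⟩ := ih
    exact ⟨(pderiv (v a)).toLinearMap.comp L, fun p => by rw [List.foldr_cons, hL]; rfl⟩

variable {R} in
omit [Fintype ι] in
/-- Iterated partial derivatives `∂/∂y_{j₁} ⋯ ∂/∂y_{j_k}` (distinct `j`'s) of a monomial: the
exponents of the `y_j` drop by one and the coefficient picks up their product.
[cite: Burgisser2024Completeness, §3.1 (p0013 L39–L47)] -/
private theorem foldr_pderiv_monomial (l : List ι) (hl : l.Nodup) (s : ι ⊕ ι × ι →₀ ℕ) (c : R) :
    l.foldr (fun j p => pderiv (Sum.inl j) p) (monomial s c) =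
      monomial (s - ∑ j ∈ l.toFinset, Finsupp.single (Sum.inl j) 1)
        (c * ∏ j ∈ l.toFinset, (s (Sum.inl j) : R)) := by
  induction l with
  | nil => simp
  | cons a l ih =>
    obtain ⟨hal, hl'⟩ := List.nodup_cons.1 hl
    have hal' : a ∉ l.toFinset := fun h => hal (List.mem_toFinset.1 h)
    have h0 : (∑ j ∈ l.toFinset, Finsupp.single (Sum.inl j : ι ⊕ ι × ι) (1 : ℕ)) (Sum.inl a) = 0 := by
      rw [Finsupp.finsetSum_apply]
      exact Finset.sum_eq_zero fun j hj =>
        Finsupp.single_eq_of_ne fun h => hal' (Sum.inl_injective h ▸ hj)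
    rw [List.foldr_cons, ih hl', pderiv_monomial, List.toFinset_cons, Finset.sum_insert hal',
      Finset.prod_insert hal', Finsupp.tsub_apply, h0, tsub_zero, tsub_tsub, add_comm]
    congr 1
    ring

/-- **Bürgisser 2024, §3.1: `∂/∂y₁ ⋯ ∂/∂yₙ f_n = PER_n`** for `f = ∏_i (Σ_j x_{ij} y_j)` — the
formula by which the survey shows that `VF`, `VBP`, `VP` are not closed under p-bounded
differentiation unless they contain `VNP` (the permanent being `VNP`-complete). The derivatives
`∂/∂y_j` (Mathlib's `pderiv`) are applied along any duplicate-free list `l` exhausting the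
`y`-variables; the result is `PER_n` in the variables `x_{ij}` (the second block). (The survey's
second expression for the same polynomial, the integral `(3/2)ⁿ ∫_{[-1,1]ⁿ} y₁⋯yₙ f_n dy`, is not
rendered.) [cite: Burgisser2024Completeness, §3.1 (p0013 L39–L47)] -/
theorem foldr_pderiv_prod_sum_X_mul_X_eq_perPoly (l : List ι) (hl : l.Nodup) (hall : ∀ j, j ∈ l) :
    l.foldr (fun j p => pderiv (Sum.inl j) p)
        (∏ i : ι, ∑ j : ι, X (Sum.inr (i, j)) * X (Sum.inl j) : MvPolynomial (ι ⊕ ι × ι) R) =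
      rename Sum.inr (perPoly ι R) := by
  obtain ⟨L, hL⟩ := exists_linearMap_foldr_pderiv (R := R) (Sum.inl : ι → ι ⊕ ι × ι) l
  have huniv : l.toFinset = Finset.univ :=
    Finset.eq_univ_iff_forall.2 fun j => List.mem_toFinset.2 (hall j)
  -- expand `f = Σ_φ ∏_i x_{i φ(i)} y_{φ(i)}`
  have hf : (∏ i : ι, ∑ j : ι, X (Sum.inr (i, j)) * X (Sum.inl j) : MvPolynomial (ι ⊕ ι × ι) R) =
      ∑ φ : ι → ι, monomial (∑ i, (Finsupp.single (Sum.inr (i, φ i)) 1 +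
        Finsupp.single (Sum.inl (φ i)) 1)) 1 := by
    rw [Fintype.prod_sum]
    refine Finset.sum_congr rfl fun φ _ => ?_
    rw [monomial_sum_one]
    refine Finset.prod_congr rfl fun i _ => ?_
    rw [X, X, monomial_mul, mul_one]
  -- the `y`-exponent of `inl j` in the `φ`-term counts the fibre of `φ` over `j`
  have happly : ∀ (φ : ι → ι) (j : ι), ((∑ i, (Finsupp.single (Sum.inr (i, φ i)) (1 : ℕ) +
      Finsupp.single (Sum.inl (φ i)) 1) : ι ⊕ ι × ι →₀ ℕ) (Sum.inl j : ι ⊕ ι × ι)) =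
        (Finset.univ.filter fun i => φ i = j).card := fun φ j => by
    rw [Finsupp.finsetSum_apply, Finset.card_filter]
    refine Finset.sum_congr rfl fun i _ => ?_
    rw [Finsupp.add_apply, Finsupp.single_eq_of_ne Sum.inl_ne_inr, zero_add, Finsupp.single_apply]
    by_cases h : φ i = j
    · rw [if_pos (congrArg Sum.inl h), if_pos h]
    · rw [if_neg (fun h' => h (Sum.inl_injective h')), if_neg h]
  -- each term: `PER`-term if `φ` is a permutation, else killed
  have hφ : ∀ φ : ι → ι, l.foldr (fun j p => pderiv (Sum.inl j) p)
      (monomial (∑ i, (Finsupp.single (Sum.inr (i, φ i)) 1 +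
        Finsupp.single (Sum.inl (φ i)) 1)) (1 : R) : MvPolynomial (ι ⊕ ι × ι) R) =
      if Function.Bijective φ then
        monomial (∑ i, Finsupp.single (Sum.inr (i, φ i) : ι ⊕ ι × ι) 1) 1 else 0 := fun φ => by
    rw [foldr_pderiv_monomial l hl, huniv, one_mul]
    simp_rw [happly]
    by_cases hb : Function.Bijective φ
    · have hys : (∑ i, Finsupp.single (Sum.inl (φ i) : ι ⊕ ι × ι) (1 : ℕ)) =
          ∑ j, Finsupp.single (Sum.inl j) 1 :=
        Equiv.sum_comp (Equiv.ofBijective φ hb) fun j => Finsupp.single (Sum.inl j : ι ⊕ ι × ι) 1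
      rw [if_pos hb, Finset.sum_add_distrib, hys, add_tsub_cancel_right]
      simp [card_filter_eq_one_of_bijective hb]
    · obtain ⟨j, hj⟩ := exists_card_filter_eq_zero_of_not_bijective hb
      rw [if_neg hb, Finset.prod_eq_zero (Finset.mem_univ j) (by rw [hj, Nat.cast_zero]),
        monomial_zero]
  rw [hf, hL, map_sum]
  simp_rw [← hL, hφ]
  rw [sum_ite_bijective_eq_sum_perm, perPoly, ← Matrix.permanent_transpose, Matrix.permanent,
    map_sum]
  refine Finset.sum_congr rfl fun σ _ => ?_
  rw [monomial_sum_one, map_prod]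
  refine Finset.prod_congr rfl fun i _ => ?_
  rw [Matrix.transpose_apply, Matrix.mvPolynomialX_apply, rename_X]
  rfl

/-- **`∂/∂y₁ ⋯ ∂/∂yₙ f_n = PER_n`**, the case `ι = Fin n` with the derivatives taken in the order
`y_{n-1}, …, y_0` (`List.finRange`). [cite: Burgisser2024Completeness, §3.1 (p0013 L39–L47)] -/
theorem foldr_pderiv_finRange_prod_sum_X_mul_X_eq_perPoly (n : ℕ) :
    (List.finRange n).foldr (fun j p => pderiv (Sum.inl j) p)
        (∏ i : Fin n, ∑ j : Fin n, X (Sum.inr (i, j)) * X (Sum.inl j) :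
          MvPolynomial (Fin n ⊕ Fin n × Fin n) R) =
      rename Sum.inr (perPoly (Fin n) R) :=
  foldr_pderiv_prod_sum_X_mul_X_eq_perPoly R (List.finRange n) (List.nodup_finRange n)
    List.mem_finRange

end Derivative

/-! ## `VF`, `VBP`, `VP` are not closed under taking coefficients unless they contain `VNP` -/

section Classes

variable (F : Type u) [Field F]

/-- **If `VP` is closed under taking coefficients, then `(PER_n) ∈ VP`** (Bürgisser 2024, §3.1:
the coefficient sequence `[Y_1 ⋯ Y_n] f_n = PER_n` of the `VP` family `(f_n)`). The hypothesis is
the closure property in the shape of Prop. 3.1 (`IsVNPFamily.coeff`) with `VP` in place of `VNP`.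
[cite: Burgisser2024Completeness, §3.1 (p0013 L28–L37)] -/
theorem isVPFamily_perPoly_of_coeff_closed
    (hVP : ∀ (a : ℕ → ℕ) (τ : ℕ → Type) [∀ k, Fintype (τ k)] [∀ k, DecidableEq (τ k)]
      (f : ∀ k, MvPolynomial (Fin (a k) ⊕ τ k) F) (m : ∀ k, Fin (a k) →₀ ℕ), IsVPFamily f →
      IsVPFamily fun k => coeff (m k) (sumAlgEquiv F (Fin (a k)) (τ k) (f k))) :
    IsVPFamily fun n => perPoly (Fin n) F := by
  have h := hVP (fun k => k) (fun k => Fin k × Fin k)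
    (fun k => ∏ i : Fin k, ∑ j : Fin k, X (Sum.inr (i, j)) * X (Sum.inl j))
    (fun k => ∑ j : Fin k, Finsupp.single j 1) (isVPFamily_prod_sum_X_mul_X F)
  simpa only [coeff_prod_sum_X_mul_X_eq_perPoly] using h

/-- **If `VBP` is closed under taking coefficients, then `(PER_n) ∈ VBP`** (Bürgisser 2024, §3.1;
`VBP` = the tree's weakly-skew class `IsVPwsFamily`, survey Def. 2.9).
[cite: Burgisser2024Completeness, §3.1 (p0013 L28–L37) and Def. 2.9 (p0006)] -/
theorem isVPwsFamily_perPoly_of_coeff_closed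
    (hVBP : ∀ (a : ℕ → ℕ) (τ : ℕ → Type) [∀ k, Fintype (τ k)] [∀ k, DecidableEq (τ k)]
      (f : ∀ k, MvPolynomial (Fin (a k) ⊕ τ k) F) (m : ∀ k, Fin (a k) →₀ ℕ), IsVPwsFamily f →
      IsVPwsFamily fun k => coeff (m k) (sumAlgEquiv F (Fin (a k)) (τ k) (f k))) :
    IsVPwsFamily fun n => perPoly (Fin n) F := by
  have h := hVBP (fun k => k) (fun k => Fin k × Fin k)
    (fun k => ∏ i : Fin k, ∑ j : Fin k, X (Sum.inr (i, j)) * X (Sum.inl j))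
    (fun k => ∑ j : Fin k, Finsupp.single j 1) (isVPwsFamily_prod_sum_X_mul_X F)
  simpa only [coeff_prod_sum_X_mul_X_eq_perPoly] using h

/-- **If `VF` is closed under taking coefficients, then `(PER_n) ∈ VF`**, i.e. `n ↦ E(PER_n)` is
p-bounded (Bürgisser 2024, §3.1; `VF = VP_e`, survey Rem. 2.10(3)).
[cite: Burgisser2024Completeness, §3.1 (p0013 L28–L37) and Def. 2.9, Rem. 2.10(3) (p0006)] -/
theorem isPBounded_formulaComplexity_perPoly_of_coeff_closed
    (hVF : ∀ (a : ℕ → ℕ) (τ : ℕ → Type) [∀ k, Fintype (τ k)] [∀ k, DecidableEq (τ k)]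
      (f : ∀ k, MvPolynomial (Fin (a k) ⊕ τ k) F) (m : ∀ k, Fin (a k) →₀ ℕ),
      (IsPBounded fun k => formulaComplexity (f k)) →
      IsPBounded fun k => formulaComplexity (coeff (m k) (sumAlgEquiv F (Fin (a k)) (τ k) (f k)))) :
    IsPBounded fun n => formulaComplexity (perPoly (Fin n) F) := by
  have h := hVF (fun k => k) (fun k => Fin k × Fin k)
    (fun k => ∏ i : Fin k, ∑ j : Fin k, X (Sum.inr (i, j)) * X (Sum.inl j))
    (fun k => ∑ j : Fin k, Finsupp.single j 1) (isPBounded_formulaComplexity_prod_sum_X_mul_X F)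
  simpa only [coeff_prod_sum_X_mul_X_eq_perPoly] using h

variable {F}

/-- **`VP` is not closed under taking coefficients unless `VP = VNP`** (Bürgisser 2024, §3.1),
as the contrapositive implication over a field of characteristic `≠ 2`: if `VP` is closed under
taking coefficients, then every p-definable family is in `VP` — by `(PER_n) ∈ VP`
(`isVPFamily_perPoly_of_coeff_closed`), the `VNP`-completeness of the permanent
(`isVNPComplete_perPoly_holds`, Valiant 1979) and the closure of `VP` under p-projections.
Nothing is asserted about whether the hypothesis holds.
[cite: Burgisser2024Completeness, §3.1 (p0013 L28–L37)] -/
theorem IsVNPFamily.isVPFamily_of_coeff_closed (h2 : ringChar F ≠ 2)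
    (hVP : ∀ (a : ℕ → ℕ) (τ : ℕ → Type) [∀ k, Fintype (τ k)] [∀ k, DecidableEq (τ k)]
      (f : ∀ k, MvPolynomial (Fin (a k) ⊕ τ k) F) (m : ∀ k, Fin (a k) →₀ ℕ), IsVPFamily f →
      IsVPFamily fun k => coeff (m k) (sumAlgEquiv F (Fin (a k)) (τ k) (f k)))
    {v : ℕ → ℕ} {g : ∀ n, MvPolynomial (Fin (v n)) F} (hg : IsVNPFamily g) : IsVPFamily g :=
  IsVPFamily.of_isPProjection_holds hg.1 ((isVNPComplete_perPoly_holds F h2).2 v g hg)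
    (isVPFamily_perPoly_of_coeff_closed F hVP)

/-- **`VBP` is not closed under taking coefficients unless `VBP ⊇ VNP`** (so in particular not
if `VP ≠ VNP`; Bürgisser 2024, §3.1), characteristic `≠ 2`: if the weakly-skew class is closed
under taking coefficients, every p-definable family has p-bounded weakly-skew complexity
(`(PER_n) ∈ VBP`, `VNP`-completeness of `PER`, `VBP` closed under p-projections).
[cite: Burgisser2024Completeness, §3.1 (p0013 L28–L37) and Def. 2.9 (p0006)] -/
theorem IsVNPFamily.isVPwsFamily_of_coeff_closed (h2 : ringChar F ≠ 2)
    (hVBP : ∀ (a : ℕ → ℕ) (τ : ℕ → Type) [∀ k, Fintype (τ k)] [∀ k, DecidableEq (τ k)]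
      (f : ∀ k, MvPolynomial (Fin (a k) ⊕ τ k) F) (m : ∀ k, Fin (a k) →₀ ℕ), IsVPwsFamily f →
      IsVPwsFamily fun k => coeff (m k) (sumAlgEquiv F (Fin (a k)) (τ k) (f k)))
    {v : ℕ → ℕ} {g : ∀ n, MvPolynomial (Fin (v n)) F} (hg : IsVNPFamily g) : IsVPwsFamily g :=
  IsVPwsFamily.of_isPProjection (isVPwsFamily_perPoly_of_coeff_closed F hVBP)
    ((isVNPComplete_perPoly_holds F h2).2 v g hg)

/-- **`VF` is not closed under taking coefficients unless `VF ⊇ VNP`** (so in particular not if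
`VP ≠ VNP`; Bürgisser 2024, §3.1), characteristic `≠ 2`: if p-bounded expression size is
preserved under taking coefficients, every p-definable family has p-bounded expression size
(`(PER_n) ∈ VF`, `VNP`-completeness of `PER`, `VF` closed under p-projections).
[cite: Burgisser2024Completeness, §3.1 (p0013 L28–L37) and Def. 2.9, Rem. 2.10(3) (p0006)] -/
theorem IsVNPFamily.isPBounded_formulaComplexity_of_coeff_closed (h2 : ringChar F ≠ 2)
    (hVF : ∀ (a : ℕ → ℕ) (τ : ℕ → Type) [∀ k, Fintype (τ k)] [∀ k, DecidableEq (τ k)]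
      (f : ∀ k, MvPolynomial (Fin (a k) ⊕ τ k) F) (m : ∀ k, Fin (a k) →₀ ℕ),
      (IsPBounded fun k => formulaComplexity (f k)) →
      IsPBounded fun k => formulaComplexity (coeff (m k) (sumAlgEquiv F (Fin (a k)) (τ k) (f k))))
    {v : ℕ → ℕ} {g : ∀ n, MvPolynomial (Fin (v n)) F} (hg : IsVNPFamily g) :
    IsPBounded fun n => formulaComplexity (g n) :=
  isPBounded_formulaComplexity_of_isPProjection
    (isPBounded_formulaComplexity_perPoly_of_coeff_closed F hVF)
    ((isVNPComplete_perPoly_holds F h2).2 v g hg)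

end Classes

/-! ## `VF`, `VBP`, `VP` are not closed under differentiation unless they contain `VNP` -/

section DiffClasses

variable (F : Type u) [Field F]

/-- `PER_n` in the variables `x_{ij}` is a (p-)projection of its copy in the variables `y ⊔ x`
(substitute `y := 0`). [cite: Burgisser2024Completeness, §3.1 (p0013 L39–L47)] -/
private theorem isPProjection_perPoly_rename_inr :
    IsPProjection (fun n => perPoly (Fin n) F)
      (fun n => rename (Sum.inr : Fin n × Fin n → Fin n ⊕ Fin n × Fin n) (perPoly (Fin n) F)) := by
  refine ⟨fun n => n, ⟨1, fun n => by rw [pow_one]; exact Nat.le_succ n⟩, fun n => ?_⟩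
  refine ⟨Sum.elim (fun _ => C 0) X, fun i => ?_, ?_⟩
  · cases i with
    | inl j => exact Or.inr ⟨0, rfl⟩
    | inr q => exact Or.inl ⟨q, rfl⟩
  · rw [aeval_rename, Sum.elim_comp_inr, aeval_X_left_apply]

/-- **If `VP` is closed under (p-boundedly many) partial derivatives, then `(PER_n) ∈ VP`**
(Bürgisser 2024, §3.1: "the classes `VF`, `VBP`, and `VP` fail to be closed under these
operations, as the following formula shows: `∂/∂y₁ ⋯ ∂/∂yₙ f_n = PER_n`"). The hypothesis asks
only for closure under differentiating once with respect to each variable of a duplicate-free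
list of distinguished variables (at most `#vars`, hence p-boundedly many, applications).
[cite: Burgisser2024Completeness, §3.1 (p0013 L39–L47)] -/
theorem isVPFamily_perPoly_of_pderiv_closed
    (hVP : ∀ (a : ℕ → ℕ) (τ : ℕ → Type) [∀ k, Fintype (τ k)] [∀ k, DecidableEq (τ k)]
      (f : ∀ k, MvPolynomial (Fin (a k) ⊕ τ k) F) (l : ∀ k, List (Fin (a k))),
      (∀ k, (l k).Nodup) → IsVPFamily f →
      IsVPFamily fun k => (l k).foldr (fun j p => pderiv (Sum.inl j) p) (f k)) :
    IsVPFamily fun n => perPoly (Fin n) F := by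
  have h := hVP (fun k => k) (fun k => Fin k × Fin k)
    (fun k => ∏ i : Fin k, ∑ j : Fin k, X (Sum.inr (i, j)) * X (Sum.inl j))
    (fun k => List.finRange k) (fun k => List.nodup_finRange k) (isVPFamily_prod_sum_X_mul_X F)
  simp only [foldr_pderiv_finRange_prod_sum_X_mul_X_eq_perPoly] at h
  exact IsVPFamily.of_isPProjection_holds (isVNPFamily_perPoly_holds F).1
    (isPProjection_perPoly_rename_inr F) h

/-- **If `VBP` is closed under (p-boundedly many) partial derivatives, then `(PER_n) ∈ VBP`**
(Bürgisser 2024, §3.1; `VBP` = `IsVPwsFamily`). [cite: Burgisser2024Completeness, §3.1 (p0013 L39–L47) and Def. 2.9 (p0006)] -/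
theorem isVPwsFamily_perPoly_of_pderiv_closed
    (hVBP : ∀ (a : ℕ → ℕ) (τ : ℕ → Type) [∀ k, Fintype (τ k)] [∀ k, DecidableEq (τ k)]
      (f : ∀ k, MvPolynomial (Fin (a k) ⊕ τ k) F) (l : ∀ k, List (Fin (a k))),
      (∀ k, (l k).Nodup) → IsVPwsFamily f →
      IsVPwsFamily fun k => (l k).foldr (fun j p => pderiv (Sum.inl j) p) (f k)) :
    IsVPwsFamily fun n => perPoly (Fin n) F := by
  have h := hVBP (fun k => k) (fun k => Fin k × Fin k)
    (fun k => ∏ i : Fin k, ∑ j : Fin k, X (Sum.inr (i, j)) * X (Sum.inl j))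
    (fun k => List.finRange k) (fun k => List.nodup_finRange k) (isVPwsFamily_prod_sum_X_mul_X F)
  simp only [foldr_pderiv_finRange_prod_sum_X_mul_X_eq_perPoly] at h
  exact IsVPwsFamily.of_isPProjection h (isPProjection_perPoly_rename_inr F)

/-- **If `VF` is closed under (p-boundedly many) partial derivatives, then `(PER_n) ∈ VF`**
(Bürgisser 2024, §3.1; `VF = VP_e`). [cite: Burgisser2024Completeness, §3.1 (p0013 L39–L47) and Def. 2.9, Rem. 2.10(3) (p0006)] -/
theorem isPBounded_formulaComplexity_perPoly_of_pderiv_closed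
    (hVF : ∀ (a : ℕ → ℕ) (τ : ℕ → Type) [∀ k, Fintype (τ k)] [∀ k, DecidableEq (τ k)]
      (f : ∀ k, MvPolynomial (Fin (a k) ⊕ τ k) F) (l : ∀ k, List (Fin (a k))),
      (∀ k, (l k).Nodup) → (IsPBounded fun k => formulaComplexity (f k)) →
      IsPBounded fun k => formulaComplexity ((l k).foldr (fun j p => pderiv (Sum.inl j) p) (f k))) :
    IsPBounded fun n => formulaComplexity (perPoly (Fin n) F) := by
  have h := hVF (fun k => k) (fun k => Fin k × Fin k)
    (fun k => ∏ i : Fin k, ∑ j : Fin k, X (Sum.inr (i, j)) * X (Sum.inl j))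
    (fun k => List.finRange k) (fun k => List.nodup_finRange k)
    (isPBounded_formulaComplexity_prod_sum_X_mul_X F)
  simp only [foldr_pderiv_finRange_prod_sum_X_mul_X_eq_perPoly] at h
  exact isPBounded_formulaComplexity_of_isPProjection h (isPProjection_perPoly_rename_inr F)

variable {F}

/-- **`VP` is not closed under p-bounded differentiation unless `VP = VNP`** (Bürgisser 2024,
§3.1), characteristic `≠ 2`, as the contrapositive implication: closure of `VP` under the
derivatives of `isVPFamily_perPoly_of_pderiv_closed` puts every p-definable family in `VP`.
[cite: Burgisser2024Completeness, §3.1 (p0013 L39–L47)] -/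
theorem IsVNPFamily.isVPFamily_of_pderiv_closed (h2 : ringChar F ≠ 2)
    (hVP : ∀ (a : ℕ → ℕ) (τ : ℕ → Type) [∀ k, Fintype (τ k)] [∀ k, DecidableEq (τ k)]
      (f : ∀ k, MvPolynomial (Fin (a k) ⊕ τ k) F) (l : ∀ k, List (Fin (a k))),
      (∀ k, (l k).Nodup) → IsVPFamily f →
      IsVPFamily fun k => (l k).foldr (fun j p => pderiv (Sum.inl j) p) (f k))
    {v : ℕ → ℕ} {g : ∀ n, MvPolynomial (Fin (v n)) F} (hg : IsVNPFamily g) : IsVPFamily g :=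
  IsVPFamily.of_isPProjection_holds hg.1 ((isVNPComplete_perPoly_holds F h2).2 v g hg)
    (isVPFamily_perPoly_of_pderiv_closed F hVP)

/-- **`VBP` is not closed under p-bounded differentiation unless `VBP ⊇ VNP`** (Bürgisser 2024,
§3.1), characteristic `≠ 2`. [cite: Burgisser2024Completeness, §3.1 (p0013 L39–L47) and Def. 2.9 (p0006)] -/
theorem IsVNPFamily.isVPwsFamily_of_pderiv_closed (h2 : ringChar F ≠ 2)
    (hVBP : ∀ (a : ℕ → ℕ) (τ : ℕ → Type) [∀ k, Fintype (τ k)] [∀ k, DecidableEq (τ k)]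
      (f : ∀ k, MvPolynomial (Fin (a k) ⊕ τ k) F) (l : ∀ k, List (Fin (a k))),
      (∀ k, (l k).Nodup) → IsVPwsFamily f →
      IsVPwsFamily fun k => (l k).foldr (fun j p => pderiv (Sum.inl j) p) (f k))
    {v : ℕ → ℕ} {g : ∀ n, MvPolynomial (Fin (v n)) F} (hg : IsVNPFamily g) : IsVPwsFamily g :=
  IsVPwsFamily.of_isPProjection (isVPwsFamily_perPoly_of_pderiv_closed F hVBP)
    ((isVNPComplete_perPoly_holds F h2).2 v g hg)

/-- **`VF` is not closed under p-bounded differentiation unless `VF ⊇ VNP`** (Bürgisser 2024,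
§3.1), characteristic `≠ 2`. [cite: Burgisser2024Completeness, §3.1 (p0013 L39–L47) and Def. 2.9, Rem. 2.10(3) (p0006)] -/
theorem IsVNPFamily.isPBounded_formulaComplexity_of_pderiv_closed (h2 : ringChar F ≠ 2)
    (hVF : ∀ (a : ℕ → ℕ) (τ : ℕ → Type) [∀ k, Fintype (τ k)] [∀ k, DecidableEq (τ k)]
      (f : ∀ k, MvPolynomial (Fin (a k) ⊕ τ k) F) (l : ∀ k, List (Fin (a k))),
      (∀ k, (l k).Nodup) → (IsPBounded fun k => formulaComplexity (f k)) →
      IsPBounded fun k => formulaComplexity ((l k).foldr (fun j p => pderiv (Sum.inl j) p) (f k)))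
    {v : ℕ → ℕ} {g : ∀ n, MvPolynomial (Fin (v n)) F} (hg : IsVNPFamily g) :
    IsPBounded fun n => formulaComplexity (g n) :=
  isPBounded_formulaComplexity_of_isPProjection
    (isPBounded_formulaComplexity_perPoly_of_pderiv_closed F hVF)
    ((isVNPComplete_perPoly_holds F h2).2 v g hg)

end DiffClasses

end Literature.Computability.AlgebraicComplexity

end
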